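import Literature.NumberTheory.Automorphic.UnitaryGroupHeisenbergRing                  -- ★ Heisenberg chart of `N`: `heisElt`, `heisX`, `heisY`, group law, `torusConj`
import Summits.HodgeConjecture.HodgeConjecture.Theorems.F0P3cStCharTSWeylHypFibre      -- ★ p849559 (A0) `mem_torusU_iff_forall_apply_eq_zero`, (A0′) `isUnit_sub_of_isRegularElt_glDiagonal`
import Summits.HodgeConjecture.HodgeConjecture.Theorems.F0P3cStCharTSWeylHypTorsor     -- ★ p849633 `antidiag_mul_antidiag_apply_eq_zero`, `weyl_apply_eq_zero`, `isRegularElt_coe_conj_iff`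
import HarnessLib

/-!
# F0 · P3c · line LH6 «StCharTS» — «TN-CONJ★»: `tN` IS ONE `N`-ORBIT FOR REGULAR `t` (the algebra under van Dijk's transform)
# [Rogawski1990 §12.5 p. 182, Lemma 12.7.1 p. 191; vanDijk1972 §2]

Cell `pub/hodgecm-mathlib`, crux H413 = `stmt-HodgeConjecture-24833` (`--supports` lane, helper); seat LH1-p01 (g3), deal «TN-CONJ★» of F0P3b-plan (g23)
2026-09-02T05:48:37Z (consumers: LH6-p05 (g2) «SURJ★» step (i), LH6-p01 (g2)'s `torusTransform`).  THEOREMS ONLY, sorry-free, no definition ∕ instance ∕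
notation ∕ named fact.

SETTING.  `U := ↥(unitaryGroupOfForm σ J)` with `J = Φ₃ = (StdForm.antidiagonal 3).over R` over a commutative ring `R` with an involution `σ` (`σ ∘ σ = id`) and
`2 ∈ Rˣ`; `T = torusU σ J`, `N = unipotentU σ J` (★ `UnitaryGroupBorelInduction`).  NO field-like hypothesis is needed.  ROAD = the ★ HEISENBERG CHART
(`UnitaryGroupHeisenbergRing`): `u ↦ (x(u), y(u)) ∈ R × R⁻` with `x(uv) = x(u)+x(v)`, `y(uv) = y(u)+y(v)+½(x(v)σx(u) − x(u)σx(v))`, and for `t = diag(d) ∈ T`: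
`x(t⁻¹ u t) = a·x(u)`, `y(t⁻¹ u t) = b·y(u)` with `a = d₀⁻¹d₁`, `b = d₀⁻¹d₂` (`σ b = b`).  REGULARITY of `t` (★ `IsRegularElt`: separable `χ_t`) gives the unit
differences `d_i − d_j ∈ Rˣ` (★ p849559 (A0′)), hence the two ROOT UNITS `a − 1 = d₀⁻¹(d₁ − d₀)`, `b − 1 = d₀⁻¹(d₂ − d₀)`.

THE EQUATION.  `n′ t n′⁻¹ = t n ⟺ t⁻¹ n′ t = n n′` is TRIANGULAR in the chart: `(a − 1)·x′ = x(n)` and `(b − 1)·y′ = y(n) + ½(x′σx(n) − x(n)σx′)` (the right side is the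
★ shear `heisShift n x′ ∈ R⁻`, and `(b−1)⁻¹` is `σ`-fixed).  Hence:
* §1 the root units (**`isUnit_rootA_sub_one`**, **`isUnit_rootB_sub_one`**), `σ`-fixedness of `(b−1)⁻¹` and chart extensionality **`heis_ext`**;
* §2 (N1)+(N2) **`exists_conj_eq_mul`**, **`eq_of_conj_eq_mul`** (uniqueness), **`existsUnique_conj_eq_mul`**: for REGULAR `t ∈ T` and every `n ∈ N` there is a UNIQUE
  `n′ ∈ N` with `n′ t n′⁻¹ = t n`; (N2′) **`eq_one_of_mul_eq_mul`**: `N ∩ Z_U(t) = 1`;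
* §3 (N3) **`setOf_conj_eq_setOf_mul`** (`{n′ t n′⁻¹ : n′ ∈ N} = t·N`) and **`bijOn_conj`** (`n′ ↦ n′ t n′⁻¹` is a bijection `N → tN`);
* §4 the `N⁻` TWIN through the Weyl element `w` (matrix `Φ₃`, a variable with `↑↑w = J`): **`weyl_mul_self`** (`w² = 1`), **`weyl_conj_mem_torusU_of_mem`**
  (`w t w⁻¹ ∈ T`, direct matrix proof), **`exists_weylConj_conj_eq_mul`** (`N⁻ = wNw⁻¹`: `t·N⁻` is one `N⁻`-orbit for regular `t`).
NOT HERE (sequel at `R = LocalRing L v`): the INTEGRAL version «`n ∈ K_m ∩ N`, `t` strictly dominant ⇒ `n′ ∈ K_m ∩ N`» (valuation bookkeeping of `(a−1)⁻¹`,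
`(b−1)⁻¹`, `½` over ★ `heisElt_mem_cmLocalIntegralLevel_iff`).

HONEST LABEL: count-neutral (TOR)-road algebra; closes no organ.  HC_CM is proved only modulo the 7 printed citations (2 remaining: hLiu418 = `stmt-HodgeConjecture-24832`,
h413 = `stmt-HodgeConjecture-24833`) until rung 0 closes.

## References
* [Rogawski1990] J. D. Rogawski, *Automorphic Representations of Unitary Groups in Three Variables*, Ann. of Math. Stud. 123 (1990), §1.10 p. 9 (`N`, `M`), §12.5 p. 182,
  Lemma 12.7.1 p. 191 (the shell functions and `m N = Ad(N) m` for regular `m`).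
* [vanDijk1972] G. van Dijk, *Computation of certain induced characters of `p`-adic groups*, Math. Ann. 199 (1972), §2 (`n ↦ m⁻¹ n⁻¹ m n` is a bijection of `N`
  for regular `m`).
-/

set_option autoImplicit false
set_option linter.dupNamespace false

open Matrix
open Literature.NumberTheory.Automorphic Literature.NumberTheory.Automorphic.UnitaryGroup Literature.NumberTheory.Automorphic.UnitaryGroup.HeisRing
open Literature.NumberTheory.Rogawski1990
open Summit.HodgeConjecture.HodgeConjecture.Cruxes.H413.F0P3cStCharTSWeylHypFibre
open Summit.HodgeConjecture.HodgeConjecture.Cruxes.H413.F0P3cStCharTSWeylHypTorsor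
open scoped MatrixGroups

namespace Summit.HodgeConjecture.HodgeConjecture.Cruxes.H413.F0P3cStCharTSTorusUnipotentConj

variable {R : Type*} [CommRing R] (σ : R →+* R) (hσ : ∀ x, σ (σ x) = x) {J : Matrix (Fin 3) (Fin 3) R}

/-! ## §1 The root units of a regular torus element; chart extensionality -/

section RootUnits

/-- For `t = diag(d) ∈ T`: extract `d` with `glDiagonal 3 R d = ↑t`. [cite: Rogawski1990, §1.10 p. 9] -/
theorem exists_glDiagonal_eq (t : ↥(torusU σ J)) : ∃ d : Fin 3 → Rˣ, glDiagonal 3 R d = ((t : ↥(unitaryGroupOfForm σ J)) : GL (Fin 3) R) := by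
  obtain ⟨d, hd⟩ := (mem_torusU_iff (t : ↥(unitaryGroupOfForm σ J))).1 t.2
  exact ⟨d, hd⟩

/-- **The root unit `a − 1 = d₀⁻¹d₁ − 1 ∈ Rˣ` of a REGULAR `t = diag(d)`** (`= d₀⁻¹(d₁ − d₀)`, ★ (A0′) unit differences).
[cite: Rogawski1990, §3.1 p. 19; §12.5 p. 182] -/
theorem isUnit_rootA_sub_one (t : ↥(torusU σ J)) {d : Fin 3 → Rˣ} (hd : glDiagonal 3 R d = ((t : ↥(unitaryGroupOfForm σ J)) : GL (Fin 3) R))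
    (hreg : IsRegularElt ((t : ↥(unitaryGroupOfForm σ J)) : GL (Fin 3) R)) : IsUnit ((((d 0)⁻¹ * d 1 : Rˣ) : R) - 1) := by
  have h10 : IsUnit ((d 1 : R) - d 0) := isUnit_sub_of_isRegularElt_glDiagonal (by rw [hd]; exact hreg) (by decide)
  have e : (((d 0)⁻¹ * d 1 : Rˣ) : R) - 1 = (((d 0)⁻¹ : Rˣ) : R) * ((d 1 : R) - d 0) := by
    rw [Units.val_mul, mul_sub, Units.inv_mul]
  rw [e]
  exact (Units.isUnit _).mul h10

/-- **The root unit `b − 1 = d₀⁻¹d₂ − 1 ∈ Rˣ` of a REGULAR `t = diag(d)`** (`= d₀⁻¹(d₂ − d₀)`). [cite: Rogawski1990, §3.1 p. 19; §12.5 p. 182] -/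
theorem isUnit_rootB_sub_one (t : ↥(torusU σ J)) {d : Fin 3 → Rˣ} (hd : glDiagonal 3 R d = ((t : ↥(unitaryGroupOfForm σ J)) : GL (Fin 3) R))
    (hreg : IsRegularElt ((t : ↥(unitaryGroupOfForm σ J)) : GL (Fin 3) R)) : IsUnit ((((d 0)⁻¹ * d 2 : Rˣ) : R) - 1) := by
  have h20 : IsUnit ((d 2 : R) - d 0) := isUnit_sub_of_isRegularElt_glDiagonal (by rw [hd]; exact hreg) (by decide)
  have e : (((d 0)⁻¹ * d 2 : Rˣ) : R) - 1 = (((d 0)⁻¹ : Rˣ) : R) * ((d 2 : R) - d 0) := by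
    rw [Units.val_mul, mul_sub, Units.inv_mul]
  rw [e]
  exact (Units.isUnit _).mul h20

/-- `σ` fixes `b − 1` (★ `map_torusCentralScalar`: `σ b = b`). [cite: Rogawski1990, §1.10 p. 9] -/
theorem map_rootB_sub_one (hJ : J = (StdForm.antidiagonal 3).over R) (t : ↥(torusU σ J)) {d : Fin 3 → Rˣ}
    (hd : glDiagonal 3 R d = ((t : ↥(unitaryGroupOfForm σ J)) : GL (Fin 3) R)) :
    σ ((((d 0)⁻¹ * d 2 : Rˣ) : R) - 1) = (((d 0)⁻¹ * d 2 : Rˣ) : R) - 1 := by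
  rw [map_sub, map_one, map_torusCentralScalar σ hJ t hd]

/-- `σ` fixes the inverse of a `σ`-fixed unit. [folklore] -/
theorem map_inv_of_map_eq {c : R} (hc : IsUnit c) (hσc : σ c = c) : σ ((hc.unit⁻¹ : Rˣ) : R) = ((hc.unit⁻¹ : Rˣ) : R) := by
  set u : Rˣ := hc.unit with hu_def
  have hu : (u : R) = c := hc.unit_spec
  have hσu : σ (u : R) = u := by rw [hu, hσc]
  calc σ ((u⁻¹ : Rˣ) : R) = σ ((u⁻¹ : Rˣ) : R) * ((u : R) * ((u⁻¹ : Rˣ) : R)) := by rw [Units.mul_inv, mul_one]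
    _ = σ ((u⁻¹ : Rˣ) : R) * σ (u : R) * ((u⁻¹ : Rˣ) : R) := by rw [hσu, mul_assoc]
    _ = ((u⁻¹ : Rˣ) : R) := by rw [← map_mul, Units.inv_mul, map_one, one_mul]

variable [Invertible (2 : R)]

/-- **Chart extensionality**: two elements of `N` with the same Heisenberg coordinates are equal (★ `heisElt_heisX_heisY`). [cite: Rogawski1990, §1.10 p. 9] -/
theorem heis_ext (hJ : J = (StdForm.antidiagonal 3).over R) {u v : ↥(unipotentU σ J)} (hx : heisX σ u = heisX σ v)
    (hy : (heisY σ hσ hJ u : R) = heisY σ hσ hJ v) : u = v := by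
  rw [← heisElt_heisX_heisY σ hσ hJ u, ← heisElt_heisX_heisY σ hσ hJ v, hx, Subtype.ext hy]

end RootUnits

/-! ## §2 (N1)+(N2) `n′ t n′⁻¹ = t n` has a unique solution `n′ ∈ N` for regular `t` -/

section Solve

variable [Invertible (2 : R)] (hJ : J = (StdForm.antidiagonal 3).over R)

omit [Invertible (2 : R)] in
/-- The group equation in chart form: `n′ t n′⁻¹ = t n ↔ t⁻¹ n′ t = n n′` (as elements of `N`, via ★ `torusConj t n′ = t⁻¹ n′ t`). [cite: vanDijk1972, §2] -/
theorem conj_eq_mul_iff_torusConj_eq (t : ↥(torusU σ J)) (n n' : ↥(unipotentU σ J)) :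
    ((n' : ↥(unitaryGroupOfForm σ J)) * t * (n' : ↥(unitaryGroupOfForm σ J))⁻¹ = t * n ↔ torusConj σ t n' = n * n') := by
  constructor
  · intro h
    apply Subtype.ext
    rw [coe_torusConj, Subgroup.coe_mul]
    calc ((t : ↥(unitaryGroupOfForm σ J)))⁻¹ * n' * t = ((t : ↥(unitaryGroupOfForm σ J)))⁻¹ * (n' * t * (n' : ↥(unitaryGroupOfForm σ J))⁻¹) * n' := by group
      _ = ((t : ↥(unitaryGroupOfForm σ J)))⁻¹ * (t * n) * n' := by rw [h]
      _ = n * n' := by group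
  · intro h
    have h' := congrArg (fun u : ↥(unipotentU σ J) => (u : ↥(unitaryGroupOfForm σ J))) h
    simp only [coe_torusConj, Subgroup.coe_mul] at h'
    calc (n' : ↥(unitaryGroupOfForm σ J)) * t * (n' : ↥(unitaryGroupOfForm σ J))⁻¹
        = t * (((t : ↥(unitaryGroupOfForm σ J)))⁻¹ * n' * t) * (n' : ↥(unitaryGroupOfForm σ J))⁻¹ := by group
      _ = t * ((n : ↥(unitaryGroupOfForm σ J)) * n') * (n' : ↥(unitaryGroupOfForm σ J))⁻¹ := by rw [h']
      _ = t * n := by group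

/-- **The chart form of the equation**: `t⁻¹ n′ t = n n′` iff `a·x′ = x(n) + x′` and `b·y′ = y(n) + y′ + ½(x′σx(n) − x(n)σx′)`, `a = d₀⁻¹d₁`, `b = d₀⁻¹d₂`
(★ `heisX_torusConj`, `coe_heisY_torusConj`, `heisX_mul`, `coe_heisY_mul`, `heis_ext`). [cite: Rogawski1990, §1.10 p. 9] [cite: vanDijk1972, §2] -/
theorem torusConj_eq_mul_iff (t : ↥(torusU σ J)) {d : Fin 3 → Rˣ} (hd : glDiagonal 3 R d = ((t : ↥(unitaryGroupOfForm σ J)) : GL (Fin 3) R))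
    (n n' : ↥(unipotentU σ J)) :
    torusConj σ t n' = n * n' ↔
      (((d 0)⁻¹ * d 1 : Rˣ) : R) * heisX σ n' = heisX σ n + heisX σ n' ∧
        (((d 0)⁻¹ * d 2 : Rˣ) : R) * (heisY σ hσ hJ n' : R) =
          (heisY σ hσ hJ n : R) + (heisY σ hσ hJ n' : R) + ⅟(2 : R) * (heisX σ n' * σ (heisX σ n) - heisX σ n * σ (heisX σ n')) := by
  constructor
  · intro h
    refine ⟨?_, ?_⟩
    · rw [← heisX_torusConj σ t hd n', h, heisX_mul]
    · rw [← coe_heisY_torusConj σ hσ hJ t hd n', h, coe_heisY_mul]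
  · rintro ⟨hx, hy⟩
    refine heis_ext σ hσ hJ ?_ ?_
    · rw [heisX_torusConj σ t hd n', hx, heisX_mul]
    · rw [coe_heisY_torusConj σ hσ hJ t hd n', hy, coe_heisY_mul]

include hσ hJ in
/-- **(N2) UNIQUENESS**: for REGULAR `t ∈ T`, two solutions `n′, n″ ∈ N` of `n′ t n′⁻¹ = t n` coincide (the chart equations have unit coefficients `a − 1`, `b − 1`).
[cite: vanDijk1972, §2] [cite: Rogawski1990, Lemma 12.7.1 p. 191] -/
theorem eq_of_conj_eq_mul (t : ↥(torusU σ J)) (hreg : IsRegularElt ((t : ↥(unitaryGroupOfForm σ J)) : GL (Fin 3) R)) (n : ↥(unipotentU σ J))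
    {n' n'' : ↥(unipotentU σ J)} (h' : (n' : ↥(unitaryGroupOfForm σ J)) * t * (n' : ↥(unitaryGroupOfForm σ J))⁻¹ = t * n)
    (h'' : (n'' : ↥(unitaryGroupOfForm σ J)) * t * (n'' : ↥(unitaryGroupOfForm σ J))⁻¹ = t * n) : n' = n'' := by
  obtain ⟨d, hd⟩ := exists_glDiagonal_eq σ t
  obtain ⟨hx', hy'⟩ := (torusConj_eq_mul_iff σ hσ hJ t hd n n').1 ((conj_eq_mul_iff_torusConj_eq σ t n n').1 h')
  obtain ⟨hx'', hy''⟩ := (torusConj_eq_mul_iff σ hσ hJ t hd n n'').1 ((conj_eq_mul_iff_torusConj_eq σ t n n'').1 h'')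
  have hA := isUnit_rootA_sub_one σ t hd hreg
  have hB := isUnit_rootB_sub_one σ t hd hreg
  -- the `x`-coordinates agree
  have hx : heisX σ n' = heisX σ n'' := by
    have e' : ((((d 0)⁻¹ * d 1 : Rˣ) : R) - 1) * heisX σ n' = heisX σ n := by rw [sub_mul, one_mul, hx', add_sub_cancel_right]
    have e'' : ((((d 0)⁻¹ * d 1 : Rˣ) : R) - 1) * heisX σ n'' = heisX σ n := by rw [sub_mul, one_mul, hx'', add_sub_cancel_right]
    exact hA.mul_left_cancel (e'.trans e''.symm)
  -- then the `y`-coordinates agree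
  have hy : (heisY σ hσ hJ n' : R) = heisY σ hσ hJ n'' := by
    have e' : ((((d 0)⁻¹ * d 2 : Rˣ) : R) - 1) * (heisY σ hσ hJ n' : R) =
        (heisY σ hσ hJ n : R) + ⅟(2 : R) * (heisX σ n' * σ (heisX σ n) - heisX σ n * σ (heisX σ n')) := by
      rw [sub_mul, one_mul, hy']; ring
    have e'' : ((((d 0)⁻¹ * d 2 : Rˣ) : R) - 1) * (heisY σ hσ hJ n'' : R) =
        (heisY σ hσ hJ n : R) + ⅟(2 : R) * (heisX σ n'' * σ (heisX σ n) - heisX σ n * σ (heisX σ n'')) := by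
      rw [sub_mul, one_mul, hy'']; ring
    rw [hx] at e'
    exact hB.mul_left_cancel (e'.trans e''.symm)
  exact heis_ext σ hσ hJ hx hy

include hσ hJ in
/-- **(N1) EXISTENCE**: for REGULAR `t ∈ T` and every `n ∈ N` there is `n′ ∈ N` with `n′ t n′⁻¹ = t n` — solve `x′ := (a−1)⁻¹ x(n)`, then
`y′ := (b−1)⁻¹ (y(n) + ½(x′σx(n) − x(n)σx′))` (the ★ shear `heisShift n x′ ∈ R⁻`; `(b−1)⁻¹` is `σ`-fixed, so `y′ ∈ R⁻`).
[cite: vanDijk1972, §2] [cite: Rogawski1990, Lemma 12.7.1 p. 191] -/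
theorem exists_conj_eq_mul (t : ↥(torusU σ J)) (hreg : IsRegularElt ((t : ↥(unitaryGroupOfForm σ J)) : GL (Fin 3) R)) (n : ↥(unipotentU σ J)) :
    ∃ n' : ↥(unipotentU σ J), (n' : ↥(unitaryGroupOfForm σ J)) * t * (n' : ↥(unitaryGroupOfForm σ J))⁻¹ = t * n := by
  obtain ⟨d, hd⟩ := exists_glDiagonal_eq σ t
  have hA := isUnit_rootA_sub_one σ t hd hreg
  have hB := isUnit_rootB_sub_one σ t hd hreg
  -- the first coordinate
  set x' : R := ((hA.unit⁻¹ : Rˣ) : R) * heisX σ n with hx'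
  -- the shear and the second coordinate
  have hB' : σ ((hB.unit⁻¹ : Rˣ) : R) = ((hB.unit⁻¹ : Rˣ) : R) := map_inv_of_map_eq σ hB (map_rootB_sub_one σ hJ t hd)
  have hymem : ((hB.unit⁻¹ : Rˣ) : R) * (heisShift σ hσ hJ n x' : R) ∈ skewPart σ := mul_mem_skewPart σ hB' (heisShift σ hσ hJ n x').2
  refine ⟨heisElt σ hσ hJ x' ⟨_, hymem⟩, ?_⟩
  rw [conj_eq_mul_iff_torusConj_eq, torusConj_eq_mul_iff σ hσ hJ t hd]
  refine ⟨?_, ?_⟩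
  · -- `a x′ = x(n) + x′ ⟺ (a−1) x′ = x(n)`
    rw [heisX_heisElt]
    have e : ((((d 0)⁻¹ * d 1 : Rˣ) : R) - 1) * x' = heisX σ n := by
      rw [hx', ← mul_assoc, hA.mul_val_inv, one_mul]
    linear_combination e
  · -- `b y′ = y(n) + y′ + ½(x′σx(n) − x(n)σx′) ⟺ (b−1) y′ = heisShift n x′`
    rw [heisX_heisElt, heisY_heisElt]
    have e : ((((d 0)⁻¹ * d 2 : Rˣ) : R) - 1) * (((hB.unit⁻¹ : Rˣ) : R) * (heisShift σ hσ hJ n x' : R)) = (heisShift σ hσ hJ n x' : R) := by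
      rw [← mul_assoc, hB.mul_val_inv, one_mul]
    have hs : (heisShift σ hσ hJ n x' : R) = (heisY σ hσ hJ n : R) + ⅟(2 : R) * (x' * σ (heisX σ n) - heisX σ n * σ x') := rfl
    change (((d 0)⁻¹ * d 2 : Rˣ) : R) * (((hB.unit⁻¹ : Rˣ) : R) * (heisShift σ hσ hJ n x' : R)) = _
    linear_combination e + hs

include hσ hJ in
/-- **(N1)+(N2) `∃!`**: for REGULAR `t ∈ T` and `n ∈ N` there is EXACTLY ONE `n′ ∈ N` with `n′ t n′⁻¹ = t n`. [cite: vanDijk1972, §2] -/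
theorem existsUnique_conj_eq_mul (t : ↥(torusU σ J)) (hreg : IsRegularElt ((t : ↥(unitaryGroupOfForm σ J)) : GL (Fin 3) R)) (n : ↥(unipotentU σ J)) :
    ∃! n' : ↥(unipotentU σ J), (n' : ↥(unitaryGroupOfForm σ J)) * t * (n' : ↥(unitaryGroupOfForm σ J))⁻¹ = t * n := by
  obtain ⟨n', h'⟩ := exists_conj_eq_mul σ hσ hJ t hreg n
  exact ⟨n', h', fun n'' h'' => eq_of_conj_eq_mul σ hσ hJ t hreg n h'' h'⟩

include hσ hJ in
/-- **(N2′) `N ∩ Z_U(t) = 1` for regular `t`**: an element of `N` commuting with a regular `t ∈ T` is trivial (`n′ = 1` and `n′` both solve the equation for `n = 1`).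
[cite: Rogawski1990, §12.5 p. 182] [cite: SpringerLAG1998, 8.1.12 (3)] -/
theorem eq_one_of_mul_eq_mul (t : ↥(torusU σ J)) (hreg : IsRegularElt ((t : ↥(unitaryGroupOfForm σ J)) : GL (Fin 3) R)) (n' : ↥(unipotentU σ J))
    (h : (n' : ↥(unitaryGroupOfForm σ J)) * t = t * n') : n' = 1 := by
  refine eq_of_conj_eq_mul σ hσ hJ t hreg 1 ?_ ?_
  · rw [h, Subgroup.coe_one, mul_one]
    group
  · rw [Subgroup.coe_one]
    group

end Solve

/-! ## §3 (N3) `{n′ t n′⁻¹ : n′ ∈ N} = t·N`, bijectively -/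

section Orbit

variable [Invertible (2 : R)] (hJ : J = (StdForm.antidiagonal 3).over R)

omit [Invertible (2 : R)] in
/-- `n′ t n′⁻¹ ∈ t·N` for EVERY `t ∈ T` (no regularity): `n′ t n′⁻¹ = t · (t⁻¹ n′ t) n′⁻¹`. [cite: Rogawski1990, §1.10 p. 9] -/
theorem exists_conj_eq_mul_of_mem (t : ↥(torusU σ J)) (n' : ↥(unipotentU σ J)) :
    ∃ n : ↥(unipotentU σ J), (n' : ↥(unitaryGroupOfForm σ J)) * t * (n' : ↥(unitaryGroupOfForm σ J))⁻¹ = t * n := by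
  refine ⟨torusConj σ t n' * n'⁻¹, ?_⟩
  rw [Subgroup.coe_mul, Subgroup.coe_inv, coe_torusConj]
  group

include hσ hJ in
/-- **(N3) `{n′ t n′⁻¹ : n′ ∈ N} = {t n : n ∈ N}`** for REGULAR `t ∈ T` (⊆ always; ⊇ is (N1)). [cite: vanDijk1972, §2] [cite: Rogawski1990, Lemma 12.7.1 p. 191] -/
theorem setOf_conj_eq_setOf_mul (t : ↥(torusU σ J)) (hreg : IsRegularElt ((t : ↥(unitaryGroupOfForm σ J)) : GL (Fin 3) R)) :
    {x : ↥(unitaryGroupOfForm σ J) | ∃ n' : ↥(unipotentU σ J), x = (n' : ↥(unitaryGroupOfForm σ J)) * t * (n' : ↥(unitaryGroupOfForm σ J))⁻¹} =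
      {x : ↥(unitaryGroupOfForm σ J) | ∃ n : ↥(unipotentU σ J), x = t * n} := by
  ext x
  constructor
  · rintro ⟨n', rfl⟩
    obtain ⟨n, hn⟩ := exists_conj_eq_mul_of_mem σ t n'
    exact ⟨n, hn⟩
  · rintro ⟨n, rfl⟩
    obtain ⟨n', hn'⟩ := exists_conj_eq_mul σ hσ hJ t hreg n
    exact ⟨n', hn'.symm⟩

include hσ hJ in
/-- **(N3) as a bijection**: `n′ ↦ n′ t n′⁻¹` maps `N` bijectively onto `t·N` for REGULAR `t ∈ T` (injective by (N2), onto by (N1)). [cite: vanDijk1972, §2] -/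
theorem bijOn_conj (t : ↥(torusU σ J)) (hreg : IsRegularElt ((t : ↥(unitaryGroupOfForm σ J)) : GL (Fin 3) R)) :
    Set.BijOn (fun n' : ↥(unipotentU σ J) => (n' : ↥(unitaryGroupOfForm σ J)) * t * (n' : ↥(unitaryGroupOfForm σ J))⁻¹) Set.univ
      {x : ↥(unitaryGroupOfForm σ J) | ∃ n : ↥(unipotentU σ J), x = t * n} := by
  refine ⟨fun n' _ => ?_, fun n' _ n'' _ h => ?_, fun x hx => ?_⟩
  · obtain ⟨n, hn⟩ := exists_conj_eq_mul_of_mem σ t n'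
    exact ⟨n, hn⟩
  · obtain ⟨n, hn⟩ := exists_conj_eq_mul_of_mem σ t n'
    have hn'' : (n'' : ↥(unitaryGroupOfForm σ J)) * t * (n'' : ↥(unitaryGroupOfForm σ J))⁻¹ = t * n := by
      have h' : (n' : ↥(unitaryGroupOfForm σ J)) * t * (n' : ↥(unitaryGroupOfForm σ J))⁻¹ =
          (n'' : ↥(unitaryGroupOfForm σ J)) * t * (n'' : ↥(unitaryGroupOfForm σ J))⁻¹ := h
      rw [← h', hn]
    exact eq_of_conj_eq_mul σ hσ hJ t hreg n hn hn''
  · obtain ⟨n, rfl⟩ := hx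
    obtain ⟨n', hn'⟩ := exists_conj_eq_mul σ hσ hJ t hreg n
    exact ⟨n', Set.mem_univ _, hn'⟩

end Orbit

/-! ## §4 The `N⁻` twin through the Weyl element -/

section Opposite

variable {w : ↥(unitaryGroupOfForm σ J)}

/-- **`w² = 1`** for the Weyl element (`Φ₃² = 1`, ★ `StdForm.over_mul_over`). [cite: Rogawski1990, §1.9 p. 8] -/
theorem weyl_mul_self (hJ : J = (StdForm.antidiagonal 3).over R) (hw : ((w : GL (Fin 3) R) : Matrix (Fin 3) (Fin 3) R) = J) : w * w = 1 := by
  apply Subtype.ext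
  apply Units.ext
  rw [Subgroup.coe_mul, Units.val_mul, hw, Subgroup.coe_one, Units.val_one, hJ, StdForm.over_mul_over]

/-- `w⁻¹ = w`. [cite: Rogawski1990, §1.9 p. 8] -/
theorem weyl_inv_eq (hJ : J = (StdForm.antidiagonal 3).over R) (hw : ((w : GL (Fin 3) R) : Matrix (Fin 3) (Fin 3) R) = J) : w⁻¹ = w :=
  inv_eq_of_mul_eq_one_right (weyl_mul_self σ hJ hw)

/-- **`w t w⁻¹ ∈ T` for `t ∈ T`** — direct matrix proof (no field-like hypothesis): `Φ₃ · diag(d)` is anti-diagonally supported, so `Φ₃ diag(d) Φ₃` is diagonal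
(★ p849633 `antidiag_mul_antidiag_apply_eq_zero`, ★ p849559 (A0)). [cite: Rogawski1990, §12.5 p. 182] -/
theorem weyl_conj_mem_torusU_of_mem (hJ : J = (StdForm.antidiagonal 3).over R) (hw : ((w : GL (Fin 3) R) : Matrix (Fin 3) (Fin 3) R) = J)
    {t : ↥(unitaryGroupOfForm σ J)} (ht : t ∈ torusU σ J) : w * t * w⁻¹ ∈ torusU σ J := by
  obtain ⟨d, hd⟩ := ht
  have hdm : ((t : GL (Fin 3) R) : Matrix (Fin 3) (Fin 3) R) = Matrix.diagonal fun k => (d k : R) := by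
    rw [← Subgroup.coe_subtype, ← hd, coe_glDiagonal]
  rw [weyl_inv_eq σ hJ hw, mem_torusU_iff_forall_apply_eq_zero]
  intro i j hij
  rw [Subgroup.coe_mul, Subgroup.coe_mul, Units.val_mul, Units.val_mul]
  refine antidiag_mul_antidiag_apply_eq_zero (G := ((w : GL (Fin 3) R) : Matrix (Fin 3) (Fin 3) R) * ((t : GL (Fin 3) R) : Matrix (Fin 3) (Fin 3) R))
    (fun i' j' hij' => ?_) (weyl_apply_eq_zero σ hJ hw) hij
  rw [hdm, Matrix.mul_diagonal, weyl_apply_eq_zero σ hJ hw i' j' hij', zero_mul]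

include hσ in
/-- **THE `N⁻` TWIN — `t·N⁻` is one `N⁻`-orbit for regular `t`**, `N⁻ := w N w⁻¹`: for `t ∈ T` regular and `m ∈ N` there is `m′ ∈ N` with
`(w m′ w⁻¹) t (w m′ w⁻¹)⁻¹ = t (w m w⁻¹)` ((N1) at the regular torus element `w⁻¹ t w = w t w⁻¹ ∈ T`, conjugated back by `w`).
[cite: vanDijk1972, §2] [cite: Rogawski1990, §12.5 p. 182] -/
theorem exists_weylConj_conj_eq_mul [Invertible (2 : R)] (hJ : J = (StdForm.antidiagonal 3).over R)
    (hw : ((w : GL (Fin 3) R) : Matrix (Fin 3) (Fin 3) R) = J) {t : ↥(unitaryGroupOfForm σ J)} (ht : t ∈ torusU σ J)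
    (hreg : IsRegularElt (t : GL (Fin 3) R)) (m : ↥(unipotentU σ J)) :
    ∃ m' : ↥(unipotentU σ J), (w * m' * w⁻¹) * t * (w * m' * w⁻¹)⁻¹ = t * (w * m * w⁻¹) := by
  -- the conjugated torus element `t′ = w t w⁻¹ = w⁻¹ t w` is regular and lies in `T`
  have ht' : w * t * w⁻¹ ∈ torusU σ J := weyl_conj_mem_torusU_of_mem σ hJ hw ht
  have hreg' : IsRegularElt ((w * t * w⁻¹ : ↥(unitaryGroupOfForm σ J)) : GL (Fin 3) R) := (isRegularElt_coe_conj_iff σ J w t).2 hreg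
  obtain ⟨m', hm'⟩ := exists_conj_eq_mul σ hσ hJ (⟨w * t * w⁻¹, ht'⟩ : ↥(torusU σ J)) hreg' m
  -- `hm' : m′ (w t w⁻¹) m′⁻¹ = (w t w⁻¹) m`; conjugate by `w` (`w⁻¹ = w`)
  refine ⟨m', ?_⟩
  have hwi := weyl_inv_eq σ hJ hw
  have h2 : (m' : ↥(unitaryGroupOfForm σ J)) * (w * t * w⁻¹) * (m' : ↥(unitaryGroupOfForm σ J))⁻¹ = w * t * w⁻¹ * m := hm'
  calc w * m' * w⁻¹ * t * (w * m' * w⁻¹)⁻¹ = w * ((m' : ↥(unitaryGroupOfForm σ J)) * (w⁻¹ * t * w) * (m' : ↥(unitaryGroupOfForm σ J))⁻¹) * w⁻¹ := by group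
    _ = w * ((m' : ↥(unitaryGroupOfForm σ J)) * (w * t * w⁻¹) * (m' : ↥(unitaryGroupOfForm σ J))⁻¹) * w⁻¹ := by rw [hwi]
    _ = w * (w * t * w⁻¹ * m) * w⁻¹ := by rw [h2]
    _ = (w * w) * t * (w⁻¹ * (m : ↥(unitaryGroupOfForm σ J))) * w⁻¹ := by group
    _ = t * (w * m * w⁻¹) := by rw [weyl_mul_self σ hJ hw, one_mul, hwi]; group

end Opposite

end Summit.HodgeConjecture.HodgeConjecture.Cruxes.H413.F0P3cStCharTSTorusUnipotentConj
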